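import Literature.Analysis.Distribution.NormalSymbolContraction
import HarnessLib

/-!
# Descent of the normal order along a second-order equation with non-degenerate normal symbol

Topic `Analysis/Distribution`; namespace `Literature.Analysis.Distribution`. The second-order step of the
uniqueness argument for distributions carried by `{0} × Z ⊂ B × Z` (Hörmander, Thm. 2.3.5 with §3.1):
if `D` is additive and homogeneous on the test functions supported in `W`, satisfies
`D (P g) = λ D g` for a second-order operator `P = Σ_κ a_κ V_κ V'_κ + Σ_l b_l U_l + c₀` with smooth
fields and coefficients, and the normal symbol `q_{z₀}(ℓ) = Σ_κ a_κ(0,z₀) ℓ(n_κ) ℓ(n'_κ)`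
(`n_κ, n'_κ` the normal components of `V_κ, V'_κ` at `(0,z₀)`) does not vanish on some real covector,
then near `(0, z₀)` the normal order of `D` drops by one, and by iteration `D` vanishes near `(0, z₀)`.

* §1 jets of `V g` for `g` flat below `n + 1` and an arbitrary smooth field `V`:
  flat below `n`, top jet `J_n(V g)(z) = J_{n+1} g (z)((V(0,z)).1, ·)`;
* §2 the operator `secondOrderOp`, flatness and top jet of `P g` for `g` flat below `j + 2`:
  `J_j(P g)(z) = contractOp (J_{j+2} g (z))`;
* §3 the identity `D (jetLift ε (T w)) = 0`;
* §4 the descent theorem and its iteration.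

Everything is proved; no named fact is introduced.

## References

* L. Hörmander, *The Analysis of Linear Partial Differential Operators I* (1983), Thm. 2.3.5, §3.1
  [HormanderALPDO1].
-/

noncomputable section

open Set Filter Topology Function Metric
open scoped ContDiff

namespace Literature.Analysis.Distribution

variable {B Z : Type*} [NormedAddCommGroup B] [NormedSpace ℝ B] [NormedAddCommGroup Z] [NormedSpace ℝ Z]

/-! ### 1. Jets of first-order derivatives along arbitrary fields -/

section FieldJet2

/-- A normal derivative appended: `J_n(∂_{(e,0)} g)(z)(v) = J_{n+1} g (z)(e, v)`. [folklore] -/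
theorem normalJet_vecDeriv_inl {g : B × Z → ℂ} (hg : ContDiff ℝ ∞ g) (n : ℕ) (e : B) (z : Z) :
    normalJet n (vecDeriv ((e, 0) : B × Z) g) z = evalFirstL (B := B) n e (normalJet (n + 1) g z) := by
  ext v
  rw [evalFirstL_apply, ← vecWordDeriv_normalWord_ofFn_eq_normalJet (hg.vecDeriv' _),
    ← vecWordDeriv_normalWord_ofFn_eq_normalJet hg, vecWordDeriv_vecDeriv' hg, ← vecWordDeriv_cons]
  have hperm : (((e, 0) : B × Z) :: normalWord (List.ofFn v)).Perm (normalWord (List.ofFn (Fin.cons e v))) := by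
    rw [List.ofFn_cons, normalWord_cons]
  rw [vecWordDeriv_perm hg hperm]

variable [FiniteDimensional ℝ B] [FiniteDimensional ℝ Z]

omit [FiniteDimensional ℝ B] [FiniteDimensional ℝ Z] in
/-- Flatness of a finite sum. [folklore] -/
theorem NormalJetsVanishBelow.finset_sum {n : ℕ} {ι : Type*} (s : Finset ι) {F : ι → B × Z → ℂ}
    (hFs : ∀ i ∈ s, ContDiff ℝ ∞ (F i)) (hF : ∀ i ∈ s, NormalJetsVanishBelow n (F i)) : NormalJetsVanishBelow n (∑ i ∈ s, F i) := by
  rw [normalJetsVanishBelow_iff_ptFlat]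
  exact fun z => PtFlat.finset_sum s hFs fun i hi => (normalJetsVanishBelow_iff_ptFlat n _).1 (hF i hi) z

omit [FiniteDimensional ℝ B] [FiniteDimensional ℝ Z] in
/-- A normal derivative costs one order of flatness. [folklore] -/
theorem NormalJetsVanishBelow.vecDeriv_inl' {n : ℕ} {g : B × Z → ℂ} (hg : ContDiff ℝ ∞ g) (hflat : NormalJetsVanishBelow (n + 1) g)
    (e : B) : NormalJetsVanishBelow n (Distribution.vecDeriv ((e, 0) : B × Z) g) := by
  simpa using hflat.vecDeriv hg ((e, 0) : B × Z)

/-- **`V g` is flat below `n` if `g` is flat below `n + 1`**, for any smooth field `V`. [folklore] -/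
theorem NormalJetsVanishBelow.fieldDerivC' {n : ℕ} {V : B × Z → B × Z} (hV : ContDiff ℝ ∞ V) {g : B × Z → ℂ} (hg : ContDiff ℝ ∞ g)
    (hflat : NormalJetsVanishBelow (n + 1) g) : NormalJetsVanishBelow n (Distribution.fieldDerivC V g) := by
  rw [fieldDerivC_eq_sum]
  have hG : ∀ i, ContDiff ℝ ∞ fun x => (fieldCoefB V i x : ℂ) * Distribution.vecDeriv (((Module.finBasis ℝ B) i, 0) : B × Z) g x :=
    fun i => (Complex.ofRealCLM.contDiff.comp (contDiff_fieldCoefB hV i)).mul (hg.vecDeriv' _)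
  have hH : ∀ k, ContDiff ℝ ∞ fun x => (fieldCoefZ V k x : ℂ) * Distribution.vecDeriv (((0 : B), (Module.finBasis ℝ Z) k) : B × Z) g x :=
    fun k => (Complex.ofRealCLM.contDiff.comp (contDiff_fieldCoefZ hV k)).mul (hg.vecDeriv' _)
  have hsumG : ContDiff ℝ ∞ (∑ i, fun x => (fieldCoefB V i x : ℂ) * Distribution.vecDeriv (((Module.finBasis ℝ B) i, 0) : B × Z) g x) := by
    rw [Finset.sum_fn]; exact ContDiff.sum fun i _ => hG i
  have hsumH : ContDiff ℝ ∞ (∑ k, fun x => (fieldCoefZ V k x : ℂ) * Distribution.vecDeriv (((0 : B), (Module.finBasis ℝ Z) k) : B × Z) g x) := by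
    rw [Finset.sum_fn]; exact ContDiff.sum fun k _ => hH k
  refine NormalJetsVanishBelow.add hsumG hsumH (NormalJetsVanishBelow.finset_sum _ (fun i _ => hG i) fun i _ => ?_)
    (NormalJetsVanishBelow.finset_sum _ (fun k _ => hH k) fun k _ => ?_)
  · exact (hflat.vecDeriv_inl' hg _).mul_left (Complex.ofRealCLM.contDiff.comp (contDiff_fieldCoefB hV i)) (hg.vecDeriv' _)
  · exact ((NormalJetsVanishBelow.vecDeriv_inr hg hflat _).mono (Nat.le_succ n)).mul_left
      (Complex.ofRealCLM.contDiff.comp (contDiff_fieldCoefZ hV k)) (hg.vecDeriv' _)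

omit [FiniteDimensional ℝ B] [FiniteDimensional ℝ Z] in
/-- `normalJet` of a finite sum of smooth functions. [folklore] -/
theorem normalJet_finset_sum {n : ℕ} {ι : Type*} (s : Finset ι) {F : ι → B × Z → ℂ} (hFs : ∀ i ∈ s, ContDiff ℝ ∞ (F i)) (z : Z) :
    normalJet n (∑ i ∈ s, F i) z = ∑ i ∈ s, normalJet n (F i) z := by
  classical
  induction s using Finset.induction_on with
  | empty =>
    ext v; simp [normalJet_apply]
  | insert a s ha ih =>
    have hs : ContDiff ℝ ∞ (∑ i ∈ s, F i) := by
      rw [Finset.sum_fn]; exact ContDiff.sum fun i hi => hFs i (Finset.mem_insert_of_mem hi)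
    rw [Finset.sum_insert ha, Finset.sum_insert ha, normalJet_add (hFs a (Finset.mem_insert_self a s)) hs,
      ih fun i hi => hFs i (Finset.mem_insert_of_mem hi)]

/-- **Top jet of `V g` for `g` flat below `n + 1`**: `J_n(V g)(z) = J_{n+1} g (z)((V(0,z)).1, ·)`. [folklore] -/
theorem normalJet_fieldDerivC' {n : ℕ} {V : B × Z → B × Z} (hV : ContDiff ℝ ∞ V) {g : B × Z → ℂ} (hg : ContDiff ℝ ∞ g)
    (hflat : NormalJetsVanishBelow (n + 1) g) (z : Z) :
    normalJet n (fieldDerivC V g) z = evalFirstL (B := B) n ((V ((0 : B), z)).1) (normalJet (n + 1) g z) := by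
  have hG : ∀ i, ContDiff ℝ ∞ fun x => (fieldCoefB V i x : ℂ) * vecDeriv (((Module.finBasis ℝ B) i, 0) : B × Z) g x :=
    fun i => (Complex.ofRealCLM.contDiff.comp (contDiff_fieldCoefB hV i)).mul (hg.vecDeriv' _)
  have hH : ∀ k, ContDiff ℝ ∞ fun x => (fieldCoefZ V k x : ℂ) * vecDeriv (((0 : B), (Module.finBasis ℝ Z) k) : B × Z) g x :=
    fun k => (Complex.ofRealCLM.contDiff.comp (contDiff_fieldCoefZ hV k)).mul (hg.vecDeriv' _)
  have hsumG : ContDiff ℝ ∞ (∑ i, fun x => (fieldCoefB V i x : ℂ) * vecDeriv (((Module.finBasis ℝ B) i, 0) : B × Z) g x) := by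
    rw [Finset.sum_fn]; exact ContDiff.sum fun i _ => hG i
  have hsumH : ContDiff ℝ ∞ (∑ k, fun x => (fieldCoefZ V k x : ℂ) * vecDeriv (((0 : B), (Module.finBasis ℝ Z) k) : B × Z) g x) := by
    rw [Finset.sum_fn]; exact ContDiff.sum fun k _ => hH k
  have hpt : PtFlat (n + 1) g z := (normalJetsVanishBelow_iff_ptFlat _ g).1 hflat z
  -- normal terms
  have hGjet : ∀ i, normalJet n (fun x => (fieldCoefB V i x : ℂ) * vecDeriv (((Module.finBasis ℝ B) i, 0) : B × Z) g x) z =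
      (fieldCoefB V i ((0 : B), z) : ℂ) • evalFirstL (B := B) n ((Module.finBasis ℝ B) i) (normalJet (n + 1) g z) := by
    intro i
    have hcs : ContDiff ℝ ∞ fun x => (fieldCoefB V i x : ℂ) := Complex.ofRealCLM.contDiff.comp (contDiff_fieldCoefB hV i)
    rw [show (fun x => (fieldCoefB V i x : ℂ) * vecDeriv (((Module.finBasis ℝ B) i, 0) : B × Z) g x) =
        (fun x => (fieldCoefB V i x : ℂ)) * vecDeriv (((Module.finBasis ℝ B) i, 0) : B × Z) g from rfl,
      normalJet_mul_of_ptFlat hcs (hg.vecDeriv' _) (by simpa using hpt.vecDeriv_inl ((Module.finBasis ℝ B) i)),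
      normalJet_vecDeriv_inl hg]
  -- tangential terms vanish
  have hHjet : ∀ k, normalJet n (fun x => (fieldCoefZ V k x : ℂ) * vecDeriv (((0 : B), (Module.finBasis ℝ Z) k) : B × Z) g x) z = 0 := by
    intro k
    have hHflat : NormalJetsVanishBelow (n + 1) (vecDeriv (((0 : B), (Module.finBasis ℝ Z) k) : B × Z) g) :=
      NormalJetsVanishBelow.vecDeriv_inr hg hflat _
    have hcs : ContDiff ℝ ∞ fun x => (fieldCoefZ V k x : ℂ) := Complex.ofRealCLM.contDiff.comp (contDiff_fieldCoefZ hV k)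
    rw [show (fun x => (fieldCoefZ V k x : ℂ) * vecDeriv (((0 : B), (Module.finBasis ℝ Z) k) : B × Z) g x) =
        (fun x => (fieldCoefZ V k x : ℂ)) * vecDeriv (((0 : B), (Module.finBasis ℝ Z) k) : B × Z) g from rfl,
      normalJet_mul_of_ptFlat hcs (hg.vecDeriv' _) (((normalJetsVanishBelow_iff_ptFlat _ _).1 hHflat z).mono (Nat.le_succ n)),
      (normalJetsVanishBelow_iff_normalJet (hg.vecDeriv' _) (n + 1)).1 hHflat n (Nat.lt_succ_self n) z]
    exact smul_zero (M := ℂ) (A := NormalJetSpace B n) _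
  rw [fieldDerivC_eq_sum, normalJet_add hsumG hsumH, normalJet_finset_sum _ (fun i _ => hG i), normalJet_finset_sum _ (fun k _ => hH k)]
  simp_rw [hGjet, hHjet]
  rw [Finset.sum_const_zero, add_zero]
  -- linearity of `evalFirstL n` in the vector
  have hV1 : (V ((0 : B), z)).1 = ∑ i, fieldCoefB V i ((0 : B), z) • (Module.finBasis ℝ B) i := by
    simp [fieldCoefB, (Module.finBasis ℝ B).sum_repr]
  rw [hV1, map_sum, sum_apply]
  refine Finset.sum_congr rfl fun i _ => ?_
  rw [map_smul, smul_apply]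
  ext v
  simp [Complex.real_smul]

end FieldJet2

/-! ### 2. Second-order operators on flat functions -/

section SecondOrder

variable [FiniteDimensional ℝ B] [FiniteDimensional ℝ Z]
variable {κ : Type*} [Fintype κ] {κ' : Type*} [Fintype κ']

/-- **A second-order operator with smooth coefficients**:
`P g = Σ_k a_k V_k (V'_k g) + Σ_l b_l U_l g + c₀ g`. [cite: HormanderALPDO1, §3.1] -/
def secondOrderOp (aC : κ → B × Z → ℂ) (V V' : κ → B × Z → B × Z) (bC : κ' → B × Z → ℂ) (U : κ' → B × Z → B × Z)
    (c0 : B × Z → ℂ) (g : B × Z → ℂ) : B × Z → ℂ :=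
  ∑ k, aC k * fieldDerivC (V k) (fieldDerivC (V' k) g) + ∑ l, bC l * fieldDerivC (U l) g + c0 * g

variable {aC : κ → B × Z → ℂ} {V V' : κ → B × Z → B × Z} {bC : κ' → B × Z → ℂ} {U : κ' → B × Z → B × Z} {c0 : B × Z → ℂ}

omit [FiniteDimensional ℝ B] [FiniteDimensional ℝ Z] [Fintype κ] [Fintype κ'] in
/-- A finite sum of test functions is a test function. [folklore] -/
theorem IsTestFn.finset_sum {ι : Type*} (s : Finset ι) {f : ι → B × Z → ℂ} (hf : ∀ i ∈ s, IsTestFn (f i)) :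
    IsTestFn (∑ i ∈ s, f i) := by
  classical
  induction s using Finset.induction_on with
  | empty => simpa using IsTestFn.zero
  | insert a s ha ih =>
    rw [Finset.sum_insert ha]
    exact (hf a (Finset.mem_insert_self a s)).add (ih fun i hi => hf i (Finset.mem_insert_of_mem hi))

omit [NormedSpace ℝ B] [NormedSpace ℝ Z] [FiniteDimensional ℝ B] [FiniteDimensional ℝ Z] [Fintype κ] [Fintype κ'] in
/-- The support of a finite sum. [folklore] -/
theorem tsupport_finset_sum_subset {ι : Type*} (s : Finset ι) {f : ι → B × Z → ℂ} {S : Set (B × Z)}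
    (hf : ∀ i ∈ s, tsupport (f i) ⊆ S) : tsupport (∑ i ∈ s, f i) ⊆ S := by
  classical
  induction s using Finset.induction_on with
  | empty => simp
  | insert a s ha ih =>
    rw [Finset.sum_insert ha]
    exact (tsupport_add _ _).trans (union_subset (hf a (Finset.mem_insert_self a s)) (ih fun i hi => hf i (Finset.mem_insert_of_mem hi)))

omit [FiniteDimensional ℝ B] [FiniteDimensional ℝ Z] in
/-- `P g` is a test function for a test function `g`. [folklore] -/
theorem isTestFn_secondOrderOp (haC : ∀ k, ContDiff ℝ ∞ (aC k)) (hV : ∀ k, ContDiff ℝ ∞ (V k)) (hV' : ∀ k, ContDiff ℝ ∞ (V' k))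
    (hbC : ∀ l, ContDiff ℝ ∞ (bC l)) (hU : ∀ l, ContDiff ℝ ∞ (U l)) (hc0 : ContDiff ℝ ∞ c0) {g : B × Z → ℂ} (hg : IsTestFn g) :
    IsTestFn (secondOrderOp aC V V' bC U c0 g) :=
  ((IsTestFn.finset_sum _ fun k _ => ((hg.fieldDerivC (hV' k)).fieldDerivC (hV k)).mul_left (haC k)).add
    (IsTestFn.finset_sum _ fun l _ => (hg.fieldDerivC (hU l)).mul_left (hbC l))).add (hg.mul_left hc0)

omit [FiniteDimensional ℝ B] [FiniteDimensional ℝ Z] in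
/-- The support of `P g` lies in that of `g`. [folklore] -/
theorem tsupport_secondOrderOp_subset (g : B × Z → ℂ) : tsupport (secondOrderOp aC V V' bC U c0 g) ⊆ tsupport g := by
  refine (tsupport_add _ _).trans (union_subset ((tsupport_add _ _).trans (union_subset ?_ ?_)) (tsupport_mul_subset_right' _ _))
  · exact tsupport_finset_sum_subset _ fun k _ =>
      (tsupport_mul_subset_right' _ _).trans ((tsupport_fieldDerivC_subset _ _).trans (tsupport_fieldDerivC_subset _ _))
  · exact tsupport_finset_sum_subset _ fun l _ =>
      (tsupport_mul_subset_right' _ _).trans (tsupport_fieldDerivC_subset _ _)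

/-- **`P g` is flat below `j` if `g` is flat below `j + 2`.** [folklore] -/
theorem NormalJetsVanishBelow.secondOrderOp (haC : ∀ k, ContDiff ℝ ∞ (aC k)) (hV : ∀ k, ContDiff ℝ ∞ (V k))
    (hV' : ∀ k, ContDiff ℝ ∞ (V' k)) (hbC : ∀ l, ContDiff ℝ ∞ (bC l)) (hU : ∀ l, ContDiff ℝ ∞ (U l)) (hc0 : ContDiff ℝ ∞ c0)
    {g : B × Z → ℂ} (hg : ContDiff ℝ ∞ g) {j : ℕ} (hflat : NormalJetsVanishBelow (j + 2) g) :
    NormalJetsVanishBelow j (Distribution.secondOrderOp aC V V' bC U c0 g) := by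
  have h1 : ∀ k, ContDiff ℝ ∞ (Distribution.fieldDerivC (V k) (Distribution.fieldDerivC (V' k) g)) :=
    fun k => contDiff_fieldDerivC (hV k) (contDiff_fieldDerivC (hV' k) hg)
  have h2 : ∀ l, ContDiff ℝ ∞ (Distribution.fieldDerivC (U l) g) := fun l => contDiff_fieldDerivC (hU l) hg
  have hsum1 : ContDiff ℝ ∞ (∑ k, aC k * Distribution.fieldDerivC (V k) (Distribution.fieldDerivC (V' k) g)) := by
    rw [Finset.sum_fn]; exact ContDiff.sum fun k _ => (haC k).mul (h1 k)
  have hsum2 : ContDiff ℝ ∞ (∑ l, bC l * Distribution.fieldDerivC (U l) g) := by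
    rw [Finset.sum_fn]; exact ContDiff.sum fun l _ => (hbC l).mul (h2 l)
  refine NormalJetsVanishBelow.add (hsum1.add hsum2) (hc0.mul hg) (NormalJetsVanishBelow.add hsum1 hsum2
    (NormalJetsVanishBelow.finset_sum _ (fun k _ => (haC k).mul (h1 k)) fun k _ => ?_)
    (NormalJetsVanishBelow.finset_sum _ (fun l _ => (hbC l).mul (h2 l)) fun l _ => ?_)) ?_
  · exact ((hflat.fieldDerivC' (hV' k) hg).fieldDerivC' (hV k) (contDiff_fieldDerivC (hV' k) hg)).mul_left (haC k) (h1 k)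
  · exact ((hflat.fieldDerivC' (hU l) hg).mono (Nat.le_succ j)).mul_left (hbC l) (h2 l)
  · exact (hflat.mono (by omega)).mul_left hc0 hg

/-- **Top jet of `P g` for `g` flat below `j + 2`**: the contraction of `J_{j+2} g` with the normal symbol.
[cite: HormanderALPDO1, Thm. 2.3.5, §3.1] -/
theorem normalJet_secondOrderOp (haC : ∀ k, ContDiff ℝ ∞ (aC k)) (hV : ∀ k, ContDiff ℝ ∞ (V k)) (hV' : ∀ k, ContDiff ℝ ∞ (V' k))
    (hbC : ∀ l, ContDiff ℝ ∞ (bC l)) (hU : ∀ l, ContDiff ℝ ∞ (U l)) (hc0 : ContDiff ℝ ∞ c0)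
    {g : B × Z → ℂ} (hg : ContDiff ℝ ∞ g) {j : ℕ} (hflat : NormalJetsVanishBelow (j + 2) g) (z : Z) :
    normalJet j (secondOrderOp aC V V' bC U c0 g) z =
      contractOp j (fun k => aC k ((0 : B), z)) (fun k => (V k ((0 : B), z)).1) (fun k => (V' k ((0 : B), z)).1)
        (normalJet (j + 2) g z) := by
  have h1 : ∀ k, ContDiff ℝ ∞ (fieldDerivC (V k) (fieldDerivC (V' k) g)) :=
    fun k => contDiff_fieldDerivC (hV k) (contDiff_fieldDerivC (hV' k) hg)
  have h2 : ∀ l, ContDiff ℝ ∞ (fieldDerivC (U l) g) := fun l => contDiff_fieldDerivC (hU l) hg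
  have hsum1 : ContDiff ℝ ∞ (∑ k, aC k * fieldDerivC (V k) (fieldDerivC (V' k) g)) := by
    rw [Finset.sum_fn]; exact ContDiff.sum fun k _ => (haC k).mul (h1 k)
  have hsum2 : ContDiff ℝ ∞ (∑ l, bC l * fieldDerivC (U l) g) := by
    rw [Finset.sum_fn]; exact ContDiff.sum fun l _ => (hbC l).mul (h2 l)
  have hfl1 : ∀ k, NormalJetsVanishBelow (j + 1) (fieldDerivC (V' k) g) := fun k => hflat.fieldDerivC' (hV' k) hg
  have hfl11 : ∀ k, NormalJetsVanishBelow j (fieldDerivC (V k) (fieldDerivC (V' k) g)) :=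
    fun k => (hfl1 k).fieldDerivC' (hV k) (contDiff_fieldDerivC (hV' k) hg)
  have hfl2 : ∀ l, NormalJetsVanishBelow (j + 1) (fieldDerivC (U l) g) := fun l => hflat.fieldDerivC' (hU l) hg
  have h12 : ContDiff ℝ ∞ (∑ k, aC k * fieldDerivC (V k) (fieldDerivC (V' k) g) + ∑ l, bC l * fieldDerivC (U l) g) :=
    hsum1.add hsum2
  have hc0g : ContDiff ℝ ∞ (c0 * g) := hc0.mul hg
  have hterm1 : ∀ k, ContDiff ℝ ∞ (aC k * fieldDerivC (V k) (fieldDerivC (V' k) g)) := fun k => (haC k).mul (h1 k)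
  have hterm2 : ∀ l, ContDiff ℝ ∞ (bC l * fieldDerivC (U l) g) := fun l => (hbC l).mul (h2 l)
  rw [secondOrderOp, normalJet_add h12 hc0g, normalJet_add hsum1 hsum2,
    normalJet_finset_sum _ (fun k _ => hterm1 k), normalJet_finset_sum _ (fun l _ => hterm2 l)]
  -- principal terms
  have hP : ∀ k, normalJet j (aC k * fieldDerivC (V k) (fieldDerivC (V' k) g)) z =
      aC k ((0 : B), z) • evalFirstL (B := B) j ((V k ((0 : B), z)).1) (evalFirstL (B := B) (j + 1) ((V' k ((0 : B), z)).1) (normalJet (j + 2) g z)) := by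
    intro k
    rw [normalJet_mul_of_ptFlat (haC k) (h1 k) ((normalJetsVanishBelow_iff_ptFlat _ _).1 (hfl11 k) z),
      normalJet_fieldDerivC' (hV k) (contDiff_fieldDerivC (hV' k) hg) (hfl1 k), normalJet_fieldDerivC' (hV' k) hg hflat]
  -- first-order terms vanish
  have hF : ∀ l, normalJet j (bC l * fieldDerivC (U l) g) z = 0 := by
    intro l
    rw [normalJet_mul_of_ptFlat (hbC l) (h2 l) (((normalJetsVanishBelow_iff_ptFlat _ _).1 (hfl2 l) z).mono (Nat.le_succ j)),
      (normalJetsVanishBelow_iff_normalJet (h2 l) (j + 1)).1 (hfl2 l) j (Nat.lt_succ_self j) z]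
    exact smul_zero (M := ℂ) (A := NormalJetSpace B j) _
  -- zeroth-order term vanishes
  have hZ : normalJet j (c0 * g) z = 0 := by
    rw [normalJet_mul_of_ptFlat hc0 hg (((normalJetsVanishBelow_iff_ptFlat _ _).1 hflat z).mono (by omega)),
      (normalJetsVanishBelow_iff_normalJet hg (j + 2)).1 hflat j (by omega) z]
    exact smul_zero (M := ℂ) (A := NormalJetSpace B j) _
  simp_rw [hP, hF]
  rw [hZ, Finset.sum_const_zero, add_zero, add_zero]
  ext v
  simp [sum_apply, smul_apply]

end SecondOrder

/-! ### 3. The key identity -/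

section Key

variable [FiniteDimensional ℝ B] [FiniteDimensional ℝ Z]
variable {κ : Type*} [Fintype κ] {κ' : Type*} [Fintype κ']
variable {D : (B × Z → ℂ) → ℂ} {Wdom : Set (B × Z)}
variable {aC : κ → B × Z → ℂ} {V V' : κ → B × Z → B × Z} {bC : κ' → B × Z → ℂ} {U : κ' → B × Z → B × Z} {c0 : B × Z → ℂ} {lam : ℂ}

/-- **The key identity of the second-order descent**: under `D (P g) = λ D g` and
`NormalOrderBelow D V₀ (j+1)`, the top-jet functional kills the image of the symmetrised contraction:
`D (jetLift ε (T w)) = 0` for every smooth `w` supported in `K` with `{‖b‖ ≤ 2ε} × K ⊆ V₀`.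
[cite: HormanderALPDO1, Thm. 2.3.5, §3.1] -/
theorem apply_jetLift_symContractOp_eq_zero (hlin : IsLocallyLinearOn Wdom D) (haC : ∀ k, ContDiff ℝ ∞ (aC k))
    (hV : ∀ k, ContDiff ℝ ∞ (V k)) (hV' : ∀ k, ContDiff ℝ ∞ (V' k)) (hbC : ∀ l, ContDiff ℝ ∞ (bC l)) (hU : ∀ l, ContDiff ℝ ∞ (U l))
    (hc0 : ContDiff ℝ ∞ c0)
    (heq : ∀ g : B × Z → ℂ, IsTestFn g → tsupport g ⊆ Wdom → D (secondOrderOp aC V V' bC U c0 g) = lam * D g)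
    {V₀ : Set (B × Z)} (hVW : V₀ ⊆ Wdom) {j : ℕ} (hD : NormalOrderBelow D V₀ (j + 1)) {ε : ℝ} (hε : 0 < ε) {K : Set Z}
    (hKV : {x : B × Z | ‖x.1‖ ≤ 2 * ε} ∩ Prod.snd ⁻¹' K ⊆ V₀)
    {w : Z → NormalJetSpace B (j + 2)} (hw : ContDiff ℝ ∞ w) (hwc : HasCompactSupport w) (hwK : tsupport w ⊆ K) :
    D (jetLift ε (fun z => symContractOp j (fun k => aC k ((0 : B), z)) (fun k => (V k ((0 : B), z)).1)
      (fun k => (V' k ((0 : B), z)).1) (w z))) = 0 := by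
  set g := jetLift ε w with hgdef
  have hgt : IsTestFn g := isTestFn_jetLift hε hw hwc
  have hgsupp : tsupport g ⊆ {x : B × Z | ‖x.1‖ ≤ 2 * ε} ∩ Prod.snd ⁻¹' K :=
    (tsupport_jetLift_subset hε w).trans (inter_subset_inter_right _ (preimage_mono hwK))
  have hgV : tsupport g ⊆ V₀ := hgsupp.trans hKV
  have hgflat : NormalJetsVanishBelow (j + 2) g := normalJetsVanishBelow_jetLift hε hw
  -- `D g = 0` and hence `D (P g) = 0`
  have hDg : D g = 0 := hD g hgt hgV (hgflat.mono (Nat.le_succ _))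
  set Pg := secondOrderOp aC V V' bC U c0 g with hPgdef
  have hPt : IsTestFn Pg := isTestFn_secondOrderOp haC hV hV' hbC hU hc0 hgt
  have hPsupp : tsupport Pg ⊆ tsupport g := tsupport_secondOrderOp_subset g
  have hPflat : NormalJetsVanishBelow j Pg := hgflat.secondOrderOp haC hV hV' hbC hU hc0 hgt.contDiff
  have hDP : D Pg = 0 := by rw [hPgdef, heq g hgt (hgV.trans hVW), hDg, mul_zero]
  -- `D (P g) = D (jetLift ε (J_j (P g)))`
  have hliftV : tsupport (jetLift ε (normalJet j Pg)) ⊆ V₀ := by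
    refine (tsupport_jetLift_subset hε _).trans ((inter_subset_inter_right _ (preimage_mono fun z hz => ?_)).trans hKV)
    exact (hgsupp (hPsupp (tsupport_normalJet_subset Pg j hz))).2
  have hDP' := NormalOrderBelow.apply_eq_apply_jetLift hlin hVW hD hε hPt (hPsupp.trans hgV) hPflat hliftV
  -- the top jet of `P g`
  have hjet : normalJet j Pg = fun z => contractOp j (fun k => aC k ((0 : B), z)) (fun k => (V k ((0 : B), z)).1)
      (fun k => (V' k ((0 : B), z)).1) (symmetrize (w z)) := by
    funext z
    rw [hPgdef, normalJet_secondOrderOp haC hV hV' hbC hU hc0 hgt.contDiff hgflat z, hgdef, normalJet_jetLift_self hε hw]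
  have hsym : (fun z => symContractOp j (fun k => aC k ((0 : B), z)) (fun k => (V k ((0 : B), z)).1)
      (fun k => (V' k ((0 : B), z)).1) (w z)) = fun z => symmetrize (normalJet j Pg z) := by
    funext z; rw [hjet, symContractOp_apply]
  rw [hsym, jetLift_symmetrize, ← hDP', hDP]

end Key

/-! ### 4. The descent theorem -/

section Descent

variable [FiniteDimensional ℝ B] [FiniteDimensional ℝ Z]
variable {κ : Type*} [Fintype κ] {κ' : Type*} [Fintype κ']
variable {D : (B × Z → ℂ) → ℂ} {Wdom : Set (B × Z)}
variable {aC : κ → B × Z → ℂ} {V V' : κ → B × Z → B × Z} {bC : κ' → B × Z → ℂ} {U : κ' → B × Z → B × Z} {c0 : B × Z → ℂ} {lam : ℂ}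

/-- **Descent of the normal order along a second-order equation with non-degenerate normal symbol**
(the second-order inductive step of Hörmander's uniqueness argument): if `D` is locally linear on `W`,
satisfies `D (P g) = λ D g`, and the normal symbol of `P` at `(0, z₀)` is non-zero on some real
covector, then for every `j` and every neighbourhood `V₀ ⊆ W` of `(0, z₀)` with
`NormalOrderBelow D V₀ (j+1)` there is a neighbourhood `V₁ ⊆ V₀` with `NormalOrderBelow D V₁ j`.
[cite: HormanderALPDO1, Thm. 2.3.5, §3.1] -/
theorem NormalOrderBelow.descent_secondOrder (hlin : IsLocallyLinearOn Wdom D) (haC : ∀ k, ContDiff ℝ ∞ (aC k))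
    (hV : ∀ k, ContDiff ℝ ∞ (V k)) (hV' : ∀ k, ContDiff ℝ ∞ (V' k)) (hbC : ∀ l, ContDiff ℝ ∞ (bC l)) (hU : ∀ l, ContDiff ℝ ∞ (U l))
    (hc0 : ContDiff ℝ ∞ c0)
    (heq : ∀ g : B × Z → ℂ, IsTestFn g → tsupport g ⊆ Wdom → D (secondOrderOp aC V V' bC U c0 g) = lam * D g)
    {z₀ : Z} {η : B →L[ℝ] ℝ}
    (hη : qForm (fun k => aC k ((0 : B), z₀)) (fun k => (V k ((0 : B), z₀)).1) (fun k => (V' k ((0 : B), z₀)).1) η ≠ 0)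
    (j : ℕ) {V₀ : Set (B × Z)} (hV₀ : V₀ ∈ 𝓝 (((0 : B), z₀) : B × Z)) (hVW : V₀ ⊆ Wdom) (hD : NormalOrderBelow D V₀ (j + 1)) :
    ∃ V₁ ∈ 𝓝 (((0 : B), z₀) : B × Z), V₁ ⊆ V₀ ∧ NormalOrderBelow D V₁ j := by
  -- smooth data along the subspace
  have h0 : ContDiff ℝ ∞ fun z : Z => (((0 : B), z) : B × Z) := (contDiff_const (c := (0 : B))).prodMk contDiff_id
  have ha : ∀ k, ContDiff ℝ ∞ fun z : Z => aC k ((0 : B), z) := fun k => (haC k).comp h0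
  have hn : ∀ k, ContDiff ℝ ∞ fun z : Z => (V k ((0 : B), z)).1 := fun k => contDiff_fst.comp ((hV k).comp h0)
  have hn' : ∀ k, ContDiff ℝ ∞ fun z : Z => (V' k ((0 : B), z)).1 := fun k => contDiff_fst.comp ((hV' k).comp h0)
  obtain ⟨O, hO, hsolve⟩ := exists_smooth_symContract_preimage j ha hn hn' hη
  obtain ⟨ρ₀, hρ₀, hρ₀O⟩ := Metric.mem_nhds_iff.1 hO
  -- the sizes
  obtain ⟨r, hr, hrV⟩ := Metric.mem_nhds_iff.1 hV₀
  set ε : ℝ := r / 4 with hεdef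
  have hε : 0 < ε := by positivity
  set ρ : ℝ := min (r / 2) (ρ₀ / 2) with hρdef
  have hρ : 0 < ρ := lt_min (by positivity) (by positivity)
  have hρr : ρ < r := (min_le_left _ _).trans_lt (by linarith)
  have hρO : closedBall z₀ ρ ⊆ O := (closedBall_subset_ball ((min_le_right _ _).trans_lt (by linarith))).trans hρ₀O
  have hKV : {x : B × Z | ‖x.1‖ ≤ 2 * ε} ∩ Prod.snd ⁻¹' closedBall z₀ ρ ⊆ V₀ :=
    (cylinder_subset_ball (by rw [hεdef]; linarith) hρr).trans hrV
  refine ⟨ball (0 : B) ε ×ˢ ball z₀ ρ, prod_mem_nhds (ball_mem_nhds _ hε) (ball_mem_nhds _ hρ), ?_, ?_⟩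
  · rintro x ⟨hx1, hx2⟩
    refine hKV ⟨?_, ?_⟩
    · rw [mem_setOf_eq]
      rw [mem_ball, dist_zero_right] at hx1
      linarith
    · exact mem_preimage.2 (ball_subset_closedBall hx2)
  · intro h hh hhV' hflat
    set m := normalJet j h
    have hm : ContDiff ℝ ∞ m := contDiff_normalJet hh.contDiff j
    have hmc : HasCompactSupport m := hasCompactSupport_normalJet hh.hasCompactSupport j
    have hmK : tsupport m ⊆ closedBall z₀ ρ := fun z hz => ball_subset_closedBall (hhV' (tsupport_normalJet_subset h j hz)).2
    have hhV : tsupport h ⊆ V₀ := hhV'.trans fun x hx => hKV ⟨by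
      rw [mem_setOf_eq]; have := hx.1; rw [mem_ball, dist_zero_right] at this; linarith,
      mem_preimage.2 (ball_subset_closedBall hx.2)⟩
    obtain ⟨w, hw, hwc, hwsupp, hweq⟩ := hsolve m hm hmc (hmK.trans hρO) fun z v σ => normalJet_comp_perm hh.contDiff z v σ
    have hliftV : tsupport (jetLift ε m) ⊆ V₀ :=
      (tsupport_jetLift_subset hε m).trans ((inter_subset_inter_right _ (preimage_mono hmK)).trans hKV)
    rw [NormalOrderBelow.apply_eq_apply_jetLift hlin hVW hD hε hh hhV hflat hliftV,
      show normalJet j h = fun z => symContractOp j (fun k => aC k ((0 : B), z)) (fun k => (V k ((0 : B), z)).1)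
        (fun k => (V' k ((0 : B), z)).1) (w z) from funext fun z => (hweq z).symm]
    exact apply_jetLift_symContractOp_eq_zero hlin haC hV hV' hbC hU hc0 heq hVW hD hε hKV hw hwc (hwsupp.trans hmK)

/-- **Iterated descent**: under the same hypotheses, `NormalOrderBelow D V₀ k` near `(0, z₀)` forces `D` to
vanish on all test functions supported in some neighbourhood of `(0, z₀)`. [cite: HormanderALPDO1, Thm. 2.3.5] -/
theorem NormalOrderBelow.vanish_of_secondOrder (hlin : IsLocallyLinearOn Wdom D) (haC : ∀ k, ContDiff ℝ ∞ (aC k))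
    (hV : ∀ k, ContDiff ℝ ∞ (V k)) (hV' : ∀ k, ContDiff ℝ ∞ (V' k)) (hbC : ∀ l, ContDiff ℝ ∞ (bC l)) (hU : ∀ l, ContDiff ℝ ∞ (U l))
    (hc0 : ContDiff ℝ ∞ c0)
    (heq : ∀ g : B × Z → ℂ, IsTestFn g → tsupport g ⊆ Wdom → D (secondOrderOp aC V V' bC U c0 g) = lam * D g)
    {z₀ : Z} {η : B →L[ℝ] ℝ}
    (hη : qForm (fun k => aC k ((0 : B), z₀)) (fun k => (V k ((0 : B), z₀)).1) (fun k => (V' k ((0 : B), z₀)).1) η ≠ 0) :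
    ∀ (k : ℕ) {V₀ : Set (B × Z)}, V₀ ∈ 𝓝 (((0 : B), z₀) : B × Z) → V₀ ⊆ Wdom → NormalOrderBelow D V₀ k →
      ∃ V₁ ∈ 𝓝 (((0 : B), z₀) : B × Z), ∀ g : B × Z → ℂ, IsTestFn g → tsupport g ⊆ V₁ → D g = 0
  | 0, V₀, hV₀, _, hD => ⟨V₀, hV₀, fun g hg hgV => hD.apply_eq_zero hg hgV⟩
  | k + 1, V₀, hV₀, hVW, hD => by
    obtain ⟨V₁, hV₁, hV₁V, hD'⟩ := NormalOrderBelow.descent_secondOrder hlin haC hV hV' hbC hU hc0 heq hη k hV₀ hVW hD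
    exact NormalOrderBelow.vanish_of_secondOrder hlin haC hV hV' hbC hU hc0 heq hη k hV₁ (hV₁V.trans hVW) hD'

end Descent


end Literature.Analysis.Distribution
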